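import Summits.QuantumFields.BalabanUV.Beta.FP.SymmetryKHolds
import Summits.QuantumFields.BalabanUV.Beta.GAN24.FibreStepResidues

/-!
# `BalabanUV.Beta.GAN24.PerfectStepFibre` — binder row G-an2-4 ∕ (CONV-C), lineage gan24-p3 (part P3, Woodbury ∕ fibre layer):
# **THE PERFECT ONE-STEP RESOLVENT AT THE FIBRE (BLOCH) LEVEL, ALL FOUR LEG BLOCKS** — the `j → ∞` limit `kFibLim` of road P1's explicit
# phase-dressed fibre function `CombesThomasFibreStep.kFib … j` EXISTS on the real Brillouin zone (uniformly, geometric tail), and the perfect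
# one-step resolvent `FP.PerfectObjectsT.KPerf Lc (sfStep Lc) (smStep d Lc) 1` (= road A2's constructed limit kernel, `KPerf_one`) IS the lattice
# kernel of that limit multiplier: `KPerf … 1 x′ y′ a b = [LegOn Lc a x′ ∧ LegOn Lc b y′] · Re latticeKernel (kFibLim Lc a x′ b y′) 0`

NOT IN PRINT; OUR PROOF (bookkeeping over tree theorems BY NAME).  HONEST FRAMING (cell contract, verbatim): «discharging `BetaPertH` makes Bałaban's UV
stability UNCONDITIONAL — a real constructive-QFT result; it is NOT the continuum limit and NOT the Clay problem.»  HONEST DEPENDENCY (verbatim): «continuum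
YM on T⁴ ⇐ BetaPertH ∧ nine spine estimates (0/9 proved); BetaPertH ⇐ (D1) ∧ (D4) ∧ CAP+tail; G-an2-4 gates asym, D1 and NE2/3/4.»

WHY.  Road FP (binder D1) types the perfect (fixed-point) resolvents `KPerf … m` as ENTRYWISE constructed limits in position space (asym1's `limMKerOf`); its
leaf N0b-K asks for their SYMBOLS.  gan24-p3 gen 12 named the multiplier quarter (`FP.PerfectSymbolKMultiplier`: `(2/Lc^{8m})·Δ_∞`).  This file names the
`m = 1` member in ALL quarters (ff ∕ fm ∕ mf ∕ mm) as ONE Bloch multiplier: road P1's K-slot inputs — (I2′) `FibreRate.realRateK` (the `j`-geometric REAL-ZONE rate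
`‖kFib_{j+1}(p) − kFib_j(p)‖ ≤ c·θ^j`, `θ = Lc⁻²`) and (I3′) `FibreStrip.fibreStrip` (the `j`-uniform strip bound `‖kFibΔ_j‖ ≤ Cst`) — say precisely that the
explicit finite fibre functions `p ↦ kFib … j a x′ b y′ p` form a UNIFORMLY CAUCHY, UNIFORMLY BOUNDED sequence on `[-π,π]^{d+1}`; so they have a limit
`kFibLim` there, dominated convergence carries the lattice kernels along, and uniqueness of limits identifies the perfect resolvent's entries.

CONTENT (all [our object] ∕ [folklore]; §1–§3 for GENERAL `d`, `Lc` under the two K-slot SHAPES `ConvCKOfShapes.RealRateK d Lc c θ` (θ < 1) and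
`ConvCKOfShapes.StripRegularK d Lc κ Cst` as HYPOTHESES of theorems — never facts; §4 at `d = 3`, every `Lc ≥ 2`, UNCONDITIONAL by `FibreRate.realRateK` ∕
`FibreStrip.fibreStrip` ∕ `FP.SymmetryKHolds.tendsto_KStepUnit_KPerf_one` BY NAME):
* §1 `kFibLim Lc a x′ b y′ := fun P => limUnder atTop (j ↦ kFib Lc (sfStep Lc) (smStep d Lc) j a x′ b y′ P)` (THE limit wherever the sequence converges — on the
  real zone under (I2′); elsewhere unspecified and never read); `tendsto_kFib_kFibLim`; the UNIFORM TAIL `norm_kFib_sub_kFibLim_le`: `‖kFib_j(p) − kFibLim(p)‖ ≤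
  c·θ^j/(1−θ)`; `norm_kFib_ofRealVec_le` ∕ `norm_kFibLim_le`: `‖kFib_j(p)‖, ‖kFibLim(p)‖ ≤ Cst` on the real zone (the phase `cphase` has modulus one there).
* §2 `tendsto_latticeKernel_kFib`: `latticeKernel (kFib … j a x′ b y′) x → latticeKernel (kFibLim … a x′ b y′) x` for every offset `x` (dominated convergence on
  the Brillouin zone, majorant `Cst`); `integrableOn_kFibLim` (the limit multiplier has an integrable lattice-kernel integrand: a.e. limit of measurable, bounded);
  `tendsto_KStepUnit_fibre`: the unit-normalised step resolvents' entries converge to `[LegOn] · Re latticeKernel kFibLim 0` (`CombesThomasFibreStep.unitK_KInvStep_eq`).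
* §3 `KPerf_one_eq_fibre_of_shapes`: under the two shapes, `KPerf Lc (sfStep Lc) (smStep d Lc) 1 x′ y′ a b = [LegOn …] · Re latticeKernel (kFibLim …) 0` (general `d`;
  `KPerf_one` + `Tendsto.limUnder_eq`); `abs_KStepUnit_sub_KPerf_one_le_of_shapes`: the SUP-NORM RATE `|KStepUnit Lc j x′ y′ a b − KPerf … 1 x′ y′ a b| ≤ c·θ^j/(1−θ)`
  (`ConvCKOfShapes.supRateK_of_realRateK` + `dist_le_of_le_geometric_of_tendsto`).
* §4 (`d = 3`, `2 ≤ Lc`): **`KPerf_one_eq_fibre`**, **`tendsto_kFib_kFibLim_holds`**, **`norm_kFib_sub_kFibLim_le_holds`** (tail constant road P1's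
  `cFF Lc + cMF Lc + cMF Lc + cmm Lc`, ratio `Lc⁻²`), **`exists_norm_kFibLim_le`**, **`tendsto_latticeKernel_kFib_holds`**, **`abs_KStepUnit_sub_KPerf_one_le`**
  (`|KStepUnit Lc j − KPerf … 1| ≤ (cFF+cMF+cMF+cmm)·(Lc⁻²)^j/(1 − Lc⁻²)` entrywise — X1-K at `m = 1` as an EXPLICIT sup-norm rate against the perfect resolvent),
  `KPerf_one_inr_off` (a multiplier leg off the coarse lattice `Lc•ℤ^{d+1}` gives `0`).
HONEST: names a limit and proves convergence to it; the `m ≥ 2` members (X1m-K ∕ X1m-der of road FP) and any CLOSED (alias-sum) form of `kFibLim` are NOT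
touched; 0 wall binders instantiated; NOT «N0b-K closed», NEVER «G-an2-4 closed», NOT BetaPertH, NOT continuum, NOT Clay.

ABSOLUTE RULE (cell, verbatim): «No internally-minted statement may enter as a cited fact. Every hypothesis is either kernel-proved in this package or a
verbatim quotation of a PUBLISHED theorem with page reference.»  Nothing is cited; no `def … : Prop`; one data `def` (`kFibLim`); every input is a tree
theorem imported BY NAME.
-/

namespace Summit.QuantumFields.BalabanUV.Beta.GAN24.PerfectStepFibre

open Filter Topology MeasureTheory Complex
open Literature.MathematicalPhysics.QuantumFieldTheory
open Literature.MathematicalPhysics.QuantumFieldTheory.Balaban1983to89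
open Literature.MathematicalPhysics.QuantumFieldTheory.Balaban1983to89.Beta
open B4Strip (ofRealVec)
open B4ContourShift (BZ integrand fourierBox latticeKernel StripRegular ofRealVec_mem_Strip norm_cexp_phase phase)
open B4Green242Bridge (latticeKernel_sub)
open FibreInverseDecay (cphase BZ_nonempty)
open LatticeForm (quo)
open ExpKernelCalculus (MKer)
open OneStepResolventKernel (Fib)
open OneStepKernelFamily (KInvStep)
open HessKerDressedLimit (limMKerOf limMKerOf_apply mker_sub_apply)
open Summit.QuantumFields.BalabanUV.Beta.HessKerDressedUnits (unitK)
open Summit.QuantumFields.BalabanUV.Beta.GAN24.CombesThomas (KStepUnit sfStep smStep SupRateK)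
open Summit.QuantumFields.BalabanUV.Beta.GAN24.CombesThomasFibre (LegOn abs_re_latticeKernel_le_of_norm_le)
open Summit.QuantumFields.BalabanUV.Beta.GAN24.CombesThomasFibreStep (kFib kFibΔ unitK_KInvStep_eq integrableOn_kFib
  integrableOn_norm_of_integrand_zero)
open Summit.QuantumFields.BalabanUV.Beta.GAN24.ConvCKOfShapes (RealRateK StripRegularK supRateK_of_realRateK)
open Summit.QuantumFields.BalabanUV.Beta.GAN24.KSlotAssembly (c_nonneg_of_realRateK)
open Summit.QuantumFields.BalabanUV.Beta.GAN24.FibreRate (cFF cMF realRateK)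
open Summit.QuantumFields.BalabanUV.Beta.GAN24.FibreRateOfLegs (cmm)
open Summit.QuantumFields.BalabanUV.Beta.GAN24.FibreStrip (fibreStrip)
open Summit.QuantumFields.BalabanUV.Beta.GAN24.FibreStepResidues (norm_cphase_ofRealVec)
open Summit.QuantumFields.BalabanUV.Beta.FP.PerfectObjectsT (KPerf KPerf_one)
open Summit.QuantumFields.BalabanUV.Beta.FP.SymmetryKHolds (tendsto_KStepUnit_KPerf_one)

noncomputable section

/-! ## §1 The limit fibre function on the real zone -/

section Generic

variable {d : ℕ} {Lc : ℕ} [NeZero Lc]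

/-- [our object] **THE LIMIT FIBRE FUNCTION OF THE PERFECT ONE-STEP RESOLVENT**: `kFibLim Lc a x′ b y′ P := lim_{j → ∞} kFib Lc (Lc^·) (Lc^{·(d+1)}) j a x′ b y′ P`
(`limUnder`: THE limit wherever the sequence of road P1's explicit phase-dressed fibre functions converges — on the real Brillouin zone under (I2′),
`tendsto_kFib_kFibLim`; its values elsewhere are never read). -/
def kFibLim (Lc : ℕ) [NeZero Lc] (a : Fib d) (x' : Fin (d + 1) → ℤ) (b : Fib d) (y' : Fin (d + 1) → ℤ) :
    (Fin (d + 1) → ℂ) → ℂ :=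
  fun P => limUnder atTop fun j => kFib Lc (sfStep Lc) (smStep d Lc) j a x' b y' P

/-- [folklore] (I2′) in `dist` form: consecutive fibre functions are `c·θ^j`-close at every real momentum. -/
theorem dist_kFib_succ_le {c θ : ℝ} (hB : RealRateK d Lc c θ) (a : Fib d) (x' : Fin (d + 1) → ℤ) (b : Fib d)
    (y' : Fin (d + 1) → ℤ) {p : Fin (d + 1) → ℝ} (hp : p ∈ BZ (d + 1)) (j : ℕ) :
    dist (kFib Lc (sfStep Lc) (smStep d Lc) j a x' b y' (ofRealVec p))
      (kFib Lc (sfStep Lc) (smStep d Lc) (j + 1) a x' b y' (ofRealVec p)) ≤ c * θ ^ j := by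
  rw [dist_comm, dist_eq_norm]
  exact hB j x' y' a b p hp

/-- [our object] Under (I2′) with `θ < 1` the fibre functions form a CAUCHY sequence at every real momentum. -/
theorem cauchySeq_kFib {c θ : ℝ} (hθ1 : θ < 1) (hB : RealRateK d Lc c θ) (a : Fib d) (x' : Fin (d + 1) → ℤ) (b : Fib d)
    (y' : Fin (d + 1) → ℤ) {p : Fin (d + 1) → ℝ} (hp : p ∈ BZ (d + 1)) :
    CauchySeq fun j => kFib Lc (sfStep Lc) (smStep d Lc) j a x' b y' (ofRealVec p) :=
  cauchySeq_of_le_geometric θ c hθ1 (dist_kFib_succ_le hB a x' b y' hp)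

/-- [our object] **CONVERGENCE ON THE REAL ZONE**: under (I2′) with `θ < 1`, `kFib … j a x′ b y′ (p) → kFibLim … a x′ b y′ (p)` for every `p ∈ [-π,π]^{d+1}`. -/
theorem tendsto_kFib_kFibLim {c θ : ℝ} (hθ1 : θ < 1) (hB : RealRateK d Lc c θ) (a : Fib d) (x' : Fin (d + 1) → ℤ) (b : Fib d)
    (y' : Fin (d + 1) → ℤ) {p : Fin (d + 1) → ℝ} (hp : p ∈ BZ (d + 1)) :
    Tendsto (fun j => kFib Lc (sfStep Lc) (smStep d Lc) j a x' b y' (ofRealVec p)) atTop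
      (𝓝 (kFibLim Lc a x' b y' (ofRealVec p))) :=
  (cauchySeq_kFib hθ1 hB a x' b y' hp).tendsto_limUnder

/-- [our object] **THE UNIFORM TAIL**: `‖kFib_j(p) − kFibLim(p)‖ ≤ c·θ^j/(1 − θ)` on the real zone (geometric series). -/
theorem norm_kFib_sub_kFibLim_le {c θ : ℝ} (hθ1 : θ < 1) (hB : RealRateK d Lc c θ) (a : Fib d) (x' : Fin (d + 1) → ℤ) (b : Fib d)
    (y' : Fin (d + 1) → ℤ) {p : Fin (d + 1) → ℝ} (hp : p ∈ BZ (d + 1)) (j : ℕ) :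
    ‖kFib Lc (sfStep Lc) (smStep d Lc) j a x' b y' (ofRealVec p) - kFibLim Lc a x' b y' (ofRealVec p)‖ ≤ c * θ ^ j / (1 - θ) := by
  rw [← dist_eq_norm]
  exact dist_le_of_le_geometric_of_tendsto θ c hθ1 (dist_kFib_succ_le hB a x' b y' hp) (tendsto_kFib_kFibLim hθ1 hB a x' b y' hp) j

/-- [folklore] At real momenta the re-based fibre function `kFibΔ` and `kFib` have the same modulus. -/
theorem norm_kFibΔ_ofRealVec (sf sm : ℕ → ℝ) (j : ℕ) (a : Fib d) (x' : Fin (d + 1) → ℤ) (b : Fib d) (y' : Fin (d + 1) → ℤ)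
    (p : Fin (d + 1) → ℝ) :
    ‖kFibΔ Lc sf sm j a x' b y' (ofRealVec p)‖ = ‖kFib Lc sf sm j a x' b y' (ofRealVec p)‖ := by
  show ‖cphase (quo Lc y' - quo Lc x') (ofRealVec p) * kFib Lc sf sm j a x' b y' (ofRealVec p)‖ = _
  rw [norm_mul, norm_cphase_ofRealVec, one_mul]

/-- [our object] **THE UNIFORM BOUND** from (I3′): `‖kFib … j a x′ b y′ (p)‖ ≤ Cst` at every real momentum, every `j`. -/
theorem norm_kFib_ofRealVec_le {κ Cst : ℝ} (hκ : 0 ≤ κ) (hA : StripRegularK d Lc κ Cst) (j : ℕ) (a : Fib d) (x' : Fin (d + 1) → ℤ)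
    (b : Fib d) (y' : Fin (d + 1) → ℤ) {p : Fin (d + 1) → ℝ} (hp : p ∈ BZ (d + 1)) :
    ‖kFib Lc (sfStep Lc) (smStep d Lc) j a x' b y' (ofRealVec p)‖ ≤ Cst := by
  rw [← norm_kFibΔ_ofRealVec]
  exact (hA j x' y' a b).bound _ (ofRealVec_mem_Strip hκ hp)

/-- [folklore] The strip constant of (I3′) is nonnegative. -/
theorem Cst_nonneg {κ Cst : ℝ} (hκ : 0 ≤ κ) (hA : StripRegularK d Lc κ Cst) : 0 ≤ Cst :=
  (norm_nonneg _).trans (norm_kFib_ofRealVec_le hκ hA 0 (Sum.inr 0) 0 (Sum.inr 0) 0 (BZ_nonempty (d + 1)).some_mem)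

/-- [our object] **THE LIMIT FIBRE FUNCTION IS BOUNDED BY THE SAME CONSTANT**: `‖kFibLim … (p)‖ ≤ Cst` on the real zone. -/
theorem norm_kFibLim_le {c θ κ Cst : ℝ} (hθ1 : θ < 1) (hB : RealRateK d Lc c θ) (hκ : 0 ≤ κ) (hA : StripRegularK d Lc κ Cst)
    (a : Fib d) (x' : Fin (d + 1) → ℤ) (b : Fib d) (y' : Fin (d + 1) → ℤ) {p : Fin (d + 1) → ℝ} (hp : p ∈ BZ (d + 1)) :
    ‖kFibLim Lc a x' b y' (ofRealVec p)‖ ≤ Cst :=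
  le_of_tendsto (tendsto_kFib_kFibLim hθ1 hB a x' b y' hp).norm
    (Eventually.of_forall fun j => norm_kFib_ofRealVec_le hκ hA j a x' b y' hp)

/-! ## §2 Dominated convergence on the Brillouin zone -/

/-- [folklore] The Brillouin zone has finite Lebesgue measure. -/
theorem volume_BZ_lt_top (d : ℕ) : volume (BZ (d + 1)) < ⊤ := by
  unfold BZ; exact isCompact_Icc.measure_lt_top

/-- [our object] **THE LATTICE KERNELS CONVERGE TO THE LATTICE KERNEL OF THE LIMIT MULTIPLIER**, every offset `x` (dominated convergence on `[-π,π]^{d+1}`: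
integrands measurable by `integrableOn_kFib`, majorant the constant `Cst` of (I3′), pointwise convergence by §1). -/
theorem tendsto_latticeKernel_kFib {c θ κ Cst : ℝ} (hθ1 : θ < 1) (hB : RealRateK d Lc c θ) (hκ : 0 ≤ κ) (hA : StripRegularK d Lc κ Cst)
    (a : Fib d) (x' : Fin (d + 1) → ℤ) (b : Fib d) (y' : Fin (d + 1) → ℤ) (x : Fin (d + 1) → ℤ) :
    Tendsto (fun j => latticeKernel (kFib Lc (sfStep Lc) (smStep d Lc) j a x' b y') x) atTop
      (𝓝 (latticeKernel (kFibLim Lc a x' b y') x)) := by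
  unfold latticeKernel fourierBox
  refine Tendsto.const_smul ?_ _
  refine tendsto_integral_of_dominated_convergence (fun _ => Cst) ?_ ?_ ?_ ?_
  · intro j
    exact (integrableOn_kFib (Lc := Lc) (sfStep Lc) (smStep d Lc) j a x' b y' x).aestronglyMeasurable
  · exact integrableOn_const (volume_BZ_lt_top d).ne
  · intro j
    refine ae_restrict_of_forall_mem (by unfold BZ; exact measurableSet_Icc) fun p hp => ?_
    unfold integrand
    rw [norm_mul, norm_cexp_phase, mul_one]
    exact norm_kFib_ofRealVec_le hκ hA j a x' b y' hp
  · refine ae_restrict_of_forall_mem (by unfold BZ; exact measurableSet_Icc) fun p hp => ?_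
    unfold integrand
    exact (tendsto_kFib_kFibLim hθ1 hB a x' b y' hp).mul_const _

/-- [our object] The limit multiplier has an integrable lattice-kernel integrand on the real zone (a.e. limit of measurable integrands, bounded by `Cst`
on a set of finite measure). -/
theorem integrableOn_kFibLim {c θ κ Cst : ℝ} (hθ1 : θ < 1) (hB : RealRateK d Lc c θ) (hκ : 0 ≤ κ) (hA : StripRegularK d Lc κ Cst)
    (a : Fib d) (x' : Fin (d + 1) → ℤ) (b : Fib d) (y' : Fin (d + 1) → ℤ) (x : Fin (d + 1) → ℤ) :
    IntegrableOn (integrand (kFibLim Lc a x' b y') x) (BZ (d + 1)) := by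
  have hmeas : AEStronglyMeasurable (integrand (kFibLim Lc a x' b y') x) (volume.restrict (BZ (d + 1))) := by
    refine aestronglyMeasurable_of_tendsto_ae atTop
      (fun j => (integrableOn_kFib (Lc := Lc) (sfStep Lc) (smStep d Lc) j a x' b y' x).aestronglyMeasurable) ?_
    refine ae_restrict_of_forall_mem (by unfold BZ; exact measurableSet_Icc) fun p hp => ?_
    unfold integrand
    exact (tendsto_kFib_kFibLim hθ1 hB a x' b y' hp).mul_const _
  refine ⟨hmeas, HasFiniteIntegral.restrict_of_bounded Cst (volume_BZ_lt_top d) ?_⟩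
  refine ae_restrict_of_forall_mem (by unfold BZ; exact measurableSet_Icc) fun p hp => ?_
  unfold integrand
  rw [norm_mul, norm_cexp_phase, mul_one]
  exact norm_kFibLim_le hθ1 hB hκ hA a x' b y' hp

/-- [our object] **THE UNIT-NORMALISED STEP RESOLVENTS CONVERGE, ENTRY BY ENTRY, TO THE LATTICE KERNEL OF THE LIMIT MULTIPLIER**:
`KStepUnit Lc j x′ y′ a b → [LegOn Lc a x′ ∧ LegOn Lc b y′] · Re latticeKernel (kFibLim Lc a x′ b y′) 0` (`CombesThomasFibreStep.unitK_KInvStep_eq` + §2). -/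
theorem tendsto_KStepUnit_fibre {c θ κ Cst : ℝ} (hθ1 : θ < 1) (hB : RealRateK d Lc c θ) (hκ : 0 ≤ κ) (hA : StripRegularK d Lc κ Cst)
    (x' y' : Fin (d + 1) → ℤ) (a b : Fib d) :
    Tendsto (fun j => KStepUnit (d := d) Lc j x' y' a b) atTop
      (𝓝 (if LegOn Lc a x' ∧ LegOn Lc b y' then (latticeKernel (kFibLim Lc a x' b y') 0).re else 0)) := by
  have h : (fun j => KStepUnit (d := d) Lc j x' y' a b) = fun j =>
      if LegOn Lc a x' ∧ LegOn Lc b y' then (latticeKernel (kFib Lc (sfStep Lc) (smStep d Lc) j a x' b y') 0).re else 0 := by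
    funext j
    exact unitK_KInvStep_eq (sfStep Lc) (smStep d Lc) j x' y' a b
  rw [h]
  split_ifs with hc
  · exact (Complex.continuous_re.tendsto _).comp (tendsto_latticeKernel_kFib hθ1 hB hκ hA a x' b y' 0)
  · exact tendsto_const_nhds

/-! ## §3 The perfect one-step resolvent as a lattice kernel, and the sup-norm rate — general `d`, under the two shapes -/

/-- [our object] **THE PERFECT ONE-STEP RESOLVENT AT THE FIBRE LEVEL (general `d`, under (I2′) ∧ (I3′))**:
`KPerf Lc (sfStep Lc) (smStep d Lc) 1 x′ y′ a b = [LegOn Lc a x′ ∧ LegOn Lc b y′] · Re latticeKernel (kFibLim Lc a x′ b y′) 0`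
(`FP.PerfectObjectsT.KPerf_one`: the perfect one-step resolvent is the ENTRYWISE `limUnder` of `KStepUnit Lc`; §2 supplies the limit). -/
theorem KPerf_one_eq_fibre_of_shapes {c θ κ Cst : ℝ} (hθ1 : θ < 1) (hB : RealRateK d Lc c θ) (hκ : 0 ≤ κ)
    (hA : StripRegularK d Lc κ Cst) (x' y' : Fin (d + 1) → ℤ) (a b : Fib d) :
    KPerf (d := d) Lc (sfStep Lc) (smStep d Lc) 1 x' y' a b =
      if LegOn Lc a x' ∧ LegOn Lc b y' then (latticeKernel (kFibLim Lc a x' b y') 0).re else 0 := by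
  rw [KPerf_one, limMKerOf_apply]
  exact (tendsto_KStepUnit_fibre hθ1 hB hκ hA x' y' a b).limUnder_eq

/-- [folklore] (I2′) ⇒ consecutive unit-normalised step resolvents are `c·θ^j`-close entrywise, in `dist` form (`ConvCKOfShapes.supRateK_of_realRateK`). -/
theorem dist_KStepUnit_succ_le {c θ : ℝ} (hθ0 : 0 ≤ θ) (hB : RealRateK d Lc c θ) (x' y' : Fin (d + 1) → ℤ) (a b : Fib d) (j : ℕ) :
    dist (KStepUnit (d := d) Lc j x' y' a b) (KStepUnit (d := d) Lc (j + 1) x' y' a b) ≤ c * θ ^ j := by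
  have h := supRateK_of_realRateK (c_nonneg_of_realRateK hB) hθ0 hB j x' y' a b
  rw [mker_sub_apply] at h
  rw [dist_comm, Real.dist_eq]
  exact h

/-- [our object] **X1-K AT `m = 1` AS AN EXPLICIT SUP-NORM RATE AGAINST THE PERFECT RESOLVENT (general `d`, under (I2′) ∧ (I3′))**:
`|KStepUnit Lc j x′ y′ a b − KPerf Lc (sfStep Lc) (smStep d Lc) 1 x′ y′ a b| ≤ c·θ^j/(1 − θ)`. -/
theorem abs_KStepUnit_sub_KPerf_one_le_of_shapes {c θ κ Cst : ℝ} (hθ0 : 0 ≤ θ) (hθ1 : θ < 1) (hB : RealRateK d Lc c θ) (hκ : 0 ≤ κ)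
    (hA : StripRegularK d Lc κ Cst) (j : ℕ) (x' y' : Fin (d + 1) → ℤ) (a b : Fib d) :
    |KStepUnit (d := d) Lc j x' y' a b - KPerf (d := d) Lc (sfStep Lc) (smStep d Lc) 1 x' y' a b| ≤ c * θ ^ j / (1 - θ) := by
  rw [← Real.dist_eq]
  have ht : Tendsto (fun j => KStepUnit (d := d) Lc j x' y' a b) atTop (𝓝 (KPerf (d := d) Lc (sfStep Lc) (smStep d Lc) 1 x' y' a b)) := by
    rw [KPerf_one_eq_fibre_of_shapes hθ1 hB hκ hA]
    exact tendsto_KStepUnit_fibre hθ1 hB hκ hA x' y' a b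
  exact dist_le_of_le_geometric_of_tendsto θ c hθ1 (dist_KStepUnit_succ_le hθ0 hB x' y' a b) ht j

end Generic

/-! ## §4 Dimension four (`d = 3`), every `Lc ≥ 2`: unconditional, road P1's (I2′) `FibreRate.realRateK` and (I3′) `FibreStrip.fibreStrip` BY NAME -/

section Four

variable {Lc : ℕ} [NeZero Lc]

omit [NeZero Lc] in
/-- [folklore] `θ = Lc⁻² < 1` for `Lc ≥ 2`, and `0 ≤ θ`. -/
theorem theta_nonneg_lt_one (hLc : 2 ≤ Lc) : (0 : ℝ) ≤ ((Lc : ℝ) ^ 2)⁻¹ ∧ ((Lc : ℝ) ^ 2)⁻¹ < 1 := by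
  have hL : (2 : ℝ) ≤ Lc := by exact_mod_cast hLc
  exact ⟨by positivity, inv_lt_one_of_one_lt₀ (by nlinarith)⟩

/-- [our object] **CONVERGENCE OF ROAD P1's FIBRE FUNCTIONS ON THE REAL ZONE, UNCONDITIONAL** (`d = 3`, `2 ≤ Lc`): for every real momentum `p ∈ [-π,π]⁴`,
every leg pair and block offsets, `kFib Lc (Lc^·) (Lc^{4·}) j a x′ b y′ (p) → kFibLim Lc a x′ b y′ (p)`. -/
theorem tendsto_kFib_kFibLim_holds (hLc : 2 ≤ Lc) (a : Fib 3) (x' : Fin (3 + 1) → ℤ) (b : Fib 3) (y' : Fin (3 + 1) → ℤ)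
    {p : Fin (3 + 1) → ℝ} (hp : p ∈ BZ (3 + 1)) :
    Tendsto (fun j => kFib Lc (sfStep Lc) (smStep 3 Lc) j a x' b y' (ofRealVec p)) atTop (𝓝 (kFibLim Lc a x' b y' (ofRealVec p))) :=
  tendsto_kFib_kFibLim (theta_nonneg_lt_one hLc).2 (realRateK hLc) a x' b y' hp

/-- [our object] **THE UNIFORM TAIL WITH ROAD P1's CONSTANTS** (`d = 3`, `2 ≤ Lc`):
`‖kFib … j a x′ b y′ (p) − kFibLim … (p)‖ ≤ (cFF Lc + cMF Lc + cMF Lc + cmm Lc)·(Lc⁻²)^j/(1 − Lc⁻²)` on the real zone. -/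
theorem norm_kFib_sub_kFibLim_le_holds (hLc : 2 ≤ Lc) (a : Fib 3) (x' : Fin (3 + 1) → ℤ) (b : Fib 3) (y' : Fin (3 + 1) → ℤ)
    {p : Fin (3 + 1) → ℝ} (hp : p ∈ BZ (3 + 1)) (j : ℕ) :
    ‖kFib Lc (sfStep Lc) (smStep 3 Lc) j a x' b y' (ofRealVec p) - kFibLim Lc a x' b y' (ofRealVec p)‖ ≤
      (cFF Lc + cMF Lc + cMF Lc + cmm Lc) * (((Lc : ℝ) ^ 2)⁻¹) ^ j / (1 - ((Lc : ℝ) ^ 2)⁻¹) :=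
  norm_kFib_sub_kFibLim_le (theta_nonneg_lt_one hLc).2 (realRateK hLc) a x' b y' hp j

/-- [our object] **THE LIMIT FIBRE FUNCTIONS ARE UNIFORMLY BOUNDED ON THE REAL ZONE** (`d = 3`, `2 ≤ Lc`): one constant (that of (I3′) `FibreStrip.fibreStrip`)
for all leg pairs and block offsets. -/
theorem exists_norm_kFibLim_le (hLc : 2 ≤ Lc) :
    ∃ Cst : ℝ, 0 ≤ Cst ∧ ∀ (a : Fib 3) (x' : Fin (3 + 1) → ℤ) (b : Fib 3) (y' : Fin (3 + 1) → ℤ), ∀ p ∈ BZ (3 + 1),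
      (∀ j, ‖kFib Lc (sfStep Lc) (smStep 3 Lc) j a x' b y' (ofRealVec p)‖ ≤ Cst) ∧ ‖kFibLim Lc a x' b y' (ofRealVec p)‖ ≤ Cst := by
  obtain ⟨κ, hκ, Cst, hA⟩ := fibreStrip (Lc := Lc)
  exact ⟨Cst, Cst_nonneg hκ.le hA, fun a x' b y' p hp =>
    ⟨fun j => norm_kFib_ofRealVec_le hκ.le hA j a x' b y' hp,
      norm_kFibLim_le (theta_nonneg_lt_one hLc).2 (realRateK hLc) hκ.le hA a x' b y' hp⟩⟩

/-- [our object] **THE LATTICE KERNELS CONVERGE, UNCONDITIONAL** (`d = 3`, `2 ≤ Lc`): `latticeKernel (kFib … j a x′ b y′) x → latticeKernel (kFibLim … a x′ b y′) x`. -/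
theorem tendsto_latticeKernel_kFib_holds (hLc : 2 ≤ Lc) (a : Fib 3) (x' : Fin (3 + 1) → ℤ) (b : Fib 3) (y' : Fin (3 + 1) → ℤ)
    (x : Fin (3 + 1) → ℤ) :
    Tendsto (fun j => latticeKernel (kFib Lc (sfStep Lc) (smStep 3 Lc) j a x' b y') x) atTop
      (𝓝 (latticeKernel (kFibLim Lc a x' b y') x)) := by
  obtain ⟨κ, hκ, Cst, hA⟩ := fibreStrip (Lc := Lc)
  exact tendsto_latticeKernel_kFib (theta_nonneg_lt_one hLc).2 (realRateK hLc) hκ.le hA a x' b y' x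

/-- [our object] The limit multiplier's lattice-kernel integrand is integrable on the real zone, UNCONDITIONAL (`d = 3`, `2 ≤ Lc`). -/
theorem integrableOn_kFibLim_holds (hLc : 2 ≤ Lc) (a : Fib 3) (x' : Fin (3 + 1) → ℤ) (b : Fib 3) (y' : Fin (3 + 1) → ℤ)
    (x : Fin (3 + 1) → ℤ) : IntegrableOn (integrand (kFibLim Lc a x' b y') x) (BZ (3 + 1)) := by
  obtain ⟨κ, hκ, Cst, hA⟩ := fibreStrip (Lc := Lc)
  exact integrableOn_kFibLim (theta_nonneg_lt_one hLc).2 (realRateK hLc) hκ.le hA a x' b y' x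

/-- **THE PERFECT ONE-STEP RESOLVENT AT THE FIBRE (BLOCH) LEVEL — ALL FOUR LEG BLOCKS, UNCONDITIONAL** (`d = 3`, every `Lc ≥ 2`, adopted units
`(sfStep Lc, smStep 3 Lc) = (Lc^j, Lc^{4j})`): for every pair of legs `a b : Fib 3` and block offsets `x′ y′`,
`KPerf Lc (sfStep Lc) (smStep 3 Lc) 1 x′ y′ a b = [LegOn Lc a x′ ∧ LegOn Lc b y′] · Re (2π)^{−4} ∫_{[-π,π]⁴} kFibLim Lc a x′ b y′ (p) dp`
— road A2's ∕ road FP's perfect one-step resolvent IS the lattice kernel (at offset `0`; the block offsets ride in the phases of `kFib`) of the real-zone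
limit of road P1's explicit fibre functions.  Uniqueness of limits: `FP.SymmetryKHolds.tendsto_KStepUnit_KPerf_one` against `tendsto_KStepUnit_fibre`
fed with `FibreRate.realRateK hLc` (I2′) and `FibreStrip.fibreStrip` (I3′). [our object] -/
theorem KPerf_one_eq_fibre (hLc : 2 ≤ Lc) (x' y' : Fin (3 + 1) → ℤ) (a b : Fib 3) :
    KPerf (d := 3) Lc (sfStep Lc) (smStep 3 Lc) 1 x' y' a b =
      if LegOn Lc a x' ∧ LegOn Lc b y' then (latticeKernel (kFibLim Lc a x' b y') 0).re else 0 := by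
  obtain ⟨κ, hκ, Cst, hA⟩ := fibreStrip (Lc := Lc)
  exact tendsto_nhds_unique (tendsto_KStepUnit_KPerf_one hLc x' y' a b)
    (tendsto_KStepUnit_fibre (theta_nonneg_lt_one hLc).2 (realRateK hLc) hκ.le hA x' y' a b)

/-- [our object] ON THE SUPPORT: both legs on (`LegOn`), the perfect entry is `Re latticeKernel (kFibLim …) 0`. -/
theorem KPerf_one_eq_fibre_of_legOn (hLc : 2 ≤ Lc) {x' y' : Fin (3 + 1) → ℤ} {a b : Fib 3} (ha : LegOn Lc a x') (hb : LegOn Lc b y') :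
    KPerf (d := 3) Lc (sfStep Lc) (smStep 3 Lc) 1 x' y' a b = (latticeKernel (kFibLim Lc a x' b y') 0).re := by
  rw [KPerf_one_eq_fibre hLc, if_pos ⟨ha, hb⟩]

/-- [our object] FIELD–FIELD block: field legs are everywhere on, so `KPerf … 1 x′ y′ (inl κ) (inl l) = Re latticeKernel (kFibLim Lc (inl κ) x′ (inl l) y′) 0`. -/
theorem KPerf_one_inl_inl (hLc : 2 ≤ Lc) (x' y' : Fin (3 + 1) → ℤ) (κ l : Fin (3 + 1)) :
    KPerf (d := 3) Lc (sfStep Lc) (smStep 3 Lc) 1 x' y' (Sum.inl κ) (Sum.inl l) =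
      (latticeKernel (kFibLim Lc (Sum.inl κ) x' (Sum.inl l) y') 0).re :=
  KPerf_one_eq_fibre_of_legOn hLc trivial trivial

/-- [our object] OFF THE SUPPORT: a multiplier leg off the coarse lattice `Lc•ℤ⁴` gives `0` (first or second leg). -/
theorem KPerf_one_off (hLc : 2 ≤ Lc) {x' y' : Fin (3 + 1) → ℤ} {a b : Fib 3} (h : ¬ LegOn Lc a x' ∨ ¬ LegOn Lc b y') :
    KPerf (d := 3) Lc (sfStep Lc) (smStep 3 Lc) 1 x' y' a b = 0 := by
  rw [KPerf_one_eq_fibre hLc, if_neg (fun hc => h.elim (fun h1 => h1 hc.1) (fun h2 => h2 hc.2))]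

/-- **X1-K AT `m = 1` AS AN EXPLICIT SUP-NORM RATE AGAINST THE PERFECT RESOLVENT, UNCONDITIONAL** (`d = 3`, every `Lc ≥ 2`): entrywise
`|KStepUnit Lc j x′ y′ a b − KPerf Lc (sfStep Lc) (smStep 3 Lc) 1 x′ y′ a b| ≤ (cFF Lc + cMF Lc + cMF Lc + cmm Lc)·(Lc⁻²)^j/(1 − Lc⁻²)` — road P1's
(I2′) constant, summed geometric tail. [our object] -/
theorem abs_KStepUnit_sub_KPerf_one_le (hLc : 2 ≤ Lc) (j : ℕ) (x' y' : Fin (3 + 1) → ℤ) (a b : Fib 3) :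
    |KStepUnit (d := 3) Lc j x' y' a b - KPerf (d := 3) Lc (sfStep Lc) (smStep 3 Lc) 1 x' y' a b| ≤
      (cFF Lc + cMF Lc + cMF Lc + cmm Lc) * (((Lc : ℝ) ^ 2)⁻¹) ^ j / (1 - ((Lc : ℝ) ^ 2)⁻¹) := by
  obtain ⟨κ, hκ, Cst, hA⟩ := fibreStrip (Lc := Lc)
  exact abs_KStepUnit_sub_KPerf_one_le_of_shapes (theta_nonneg_lt_one hLc).1 (theta_nonneg_lt_one hLc).2 (realRateK hLc) hκ.le hA j x' y' a b

/-- [our object] The same in the `Tendsto` currency with road P1's data only (no appeal to `SymmetryKHolds`): `KStepUnit Lc j x′ y′ a b → [LegOn] · Re latticeKernel kFibLim 0`. -/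
theorem tendsto_KStepUnit_fibre_holds (hLc : 2 ≤ Lc) (x' y' : Fin (3 + 1) → ℤ) (a b : Fib 3) :
    Tendsto (fun j => KStepUnit (d := 3) Lc j x' y' a b) atTop
      (𝓝 (if LegOn Lc a x' ∧ LegOn Lc b y' then (latticeKernel (kFibLim Lc a x' b y') 0).re else 0)) := by
  obtain ⟨κ, hκ, Cst, hA⟩ := fibreStrip (Lc := Lc)
  exact tendsto_KStepUnit_fibre (theta_nonneg_lt_one hLc).2 (realRateK hLc) hκ.le hA x' y' a b

end Four

end

end Summit.QuantumFields.BalabanUV.Beta.GAN24.PerfectStepFibre
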